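import Summits.FinalStateConjecture.FinalStateConjecture.Theses.ClusterCompleteness
import Summits.FinalStateConjecture.FinalStateConjecture.Theses.DerivativeThrift
import Summits.FinalStateConjecture.FinalStateConjecture.Theorems.ClusterCompletenessOmegaLimitMultiKerrBirthDefs
import Summits.FinalStateConjecture.FinalStateConjecture.Theorems.ClusterCompletenessLinearToNonlinearCaptureSyncRecurrenceDefs
import Summits.FinalStateConjecture.FinalStateConjecture.Theorems.ClusterCompletenessOmegaLimitMultiKerrStubOrderUpgradeAssembly
import Summits.FinalStateConjecture.FinalStateConjecture.Theorems.ClusterCompletenessLinearToNonlinearCaptureStubScriOfEntry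
import Summits.FinalStateConjecture.FinalStateConjecture.Theorems.ClusterCompletenessLinearToNonlinearCaptureStubRaysStayInClosureTransferCofinal
import Summits.FinalStateConjecture.FinalStateConjecture.Theorems.StarvedNecksHonestFixedRadiusSettlingStubEntryBookkeeping
import Literature.Geometry.Lorentzian.HorizonLineage
import Literature.Geometry.Lorentzian.LeviCivitaProofs

/-!
# Crux `LinearToNonlinearCapture` (stmt-FinalStateConjecture-14526) — skeleton of line
# `thrift-handoff`, v3.1 (lead c15, 2026-08-17, synchronisation reshape of S_M₃ over `RecursSync`; v2/v2.1 lead c14, `prover-line-stmt-FinalStateConjecture-14526-c14-0`, 2026-08-17,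
# after wave 1; v1 = crux-strategist gen 1, `STRATEGY-CENSUS.md` §Transfer)

Crux: `LinearToNonlinearCapture := AdiabaticMultiKerrILED → RecurrentMultiKerrCapture` (`#2 → X`,
route `ClusterCompleteness` rev 21). `#2` is inert (Cert14526), so the line proves
`X ≡ ∃ k, ∀ 𝒟, RecursO k 𝒟 → complete 𝓘⁺ ∧ SettlesT2 𝒟` (landed vocabulary `RecursO`, BirthDefs).

THE LINE (transfer of the capture core onto the layer-restart architecture of the sibling route
DerivativeThrift): MANUFACTURE S_M (recurrence ⇒ for every scale/accuracy/lateness an ε-thrifty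
`N`-hole restart layer, `RecedingKerr.layer`, layer norm `𝔑_(3,1/2,1/2) ≤ ε`) + RESTART (S_K = the
single-Kerr layer-stability theorem, S_T = the `N`-hole settling theorem fed by S_K) + RAYS (S_R) + the
scri column of the live line `exterior-entry-capture` (F″, G′, landed S_C).

v2 RESHAPE (wave 1 of lead c14: three workers, findings attached to the item as evidence):
* S_R (v1 `stub_raysStayInClosure_transfer`, "ray clause for EVERY honest `d′` under `RecursO k` +
  far chart") was MIS-STATED: no hypothesis put a point of the recurrent exterior `O` on the left, so
  the goal reduced exactly to the underivable `late recurrent chart images ⊆ closure O′` — a `d′`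
  charting a pocket behind a horizon is excluded by nothing (the sibling's `ThriftyHandoff`, stmt-17612,
  carries this clause GENERICALLY with that very why-might-fail). v2: S_R′
  `stub_raysStayInClosure_transfer_cofinal` is the COFINAL TRANSFER (ray clause of a charted exterior
  `exteriorOf U` + `U ⊆ closure O′` ⇒ ray clause of `O′`; proved sorry-free by the worker: `I⁺(q)` open,
  `≪ ∘ ≪ ⊆ ≪`, and `O = exteriorOf (late images after τ₁)` for every `τ₁ > τ₀` from RecursO's C2/C3/C8/
  C10), and the cofinality obligation moves into the restart S_T⁺ as an explicit certificate conjunct.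
* S_T (v1 `stub_clusterSettlingFarControlled`, `TKS → far chart → hand-over → settles`, NO recurrence)
  was MIS-STATED (heuristically false on ∀-data, modulo far-development existence U1, exactly as every
  fixed-order `X_k`, `k ≤ 3`): (F1) thin far caps aimed at late BOUNDED-radius events cross the far
  leaves of every late layer at cost `𝔑_(2,1/2,1/2) ≈ σ²(ηS)^{1/2}t^{-3/4} → 0` while their focal `C²`
  size is `S ≥ 1`; (F2) the `u → −∞` swarm never meets any layer and is invisible to F″'s `C⁰/C¹`, while
  the consequent forces whole-slab `C²` outer flatness. Only whole-slab recurrence closes both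
  (`RecursO₄` fails on cap data); thrift order 3 closes (F1) only. v2: S_T⁺ `stub_clusterSettlingRecurrent`
  takes `RecursO k 𝒟` (`∃ k`), which also supplies the outer flat chart, separation C7, exhaustion C10,
  orientation C11 and the ray clause C9 — so the far-chart hypothesis is dropped from S_T⁺ (F″ now feeds
  the scri column only) — and concludes the settle matrix PLUS the cofinality certificate S_R′ consumes.
* S_K (v1 `stub_thriftyKerrStability := Theses.DerivativeThrift.ThriftyKerrStability` BY NAME, thrift
  order 2) is hit by the same (F1) caps (their focal events lie on the truncated near-zone slabs of every
  admissible witness chart), `TKS₃` is not. v2: S_K₃ `stub_thriftyKerrStability3` = the sibling's text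
  VERBATIM with the layer norm at order `3 (1/2) (1/2)` (cross-route alert filed on stmt-17610/17611; when
  DerivativeThrift restates at order 3, S_K₃ closes by two lines of glue); S_M and S_T⁺ hand over at
  order 3 accordingly (`∃ k` absorbs the extra recurrence order the flux bookkeeping needs: whole-slab
  order ≥ 5 for the order-2 fluxes (worker W3 K1(b): admissible tails `r^{-1-a-2b} sin r^b` give
  `𝔑 = ∞` on every late layer while `D⁴h → 0`) and order ≥ 7 at thrift order 3 (workers W4/W6:
  intermittent tails `b = (7+a−4δ′)/4` are `RecursO₆`-compatible with `(b)₃ = ∞`; Landau–Kolmogorov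
  closes the window at 7)).
* S_M additionally carries a THIRD piece no earlier seat named (lead c14, confirmed by the S_K worker
  from the definitions): `RecedingKerr.layer` is excised at `rᵢ = Mᵢ ∈ (r₋, r₊)` — INSIDE the event
  horizons — while RecursO's hole charts live on `boostedKerrExterior = {r > max r₊ 0}`; the future
  domain of dependence of an exterior slab piece contains no interior point, so "short-time Cauchy
  stability from the recurrent `Cᵏ` jet" has no input on the collar `{Mᵢ < rᵢ ≤ r₊}`: INTERIOR COLLAR
  CONTROL (area-law pinning of the late horizon flux by the recurring mass labels + red-shift Cauchy
  stability along `𝓗⁺`, energy → `C³` upgrade) is part of S_M, unprinted as stated.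

v2.1 (wave 2 of lead c14: three audit workers on the v2 stubs): (W4) the order-3 move VERIFIED
independently (TKS₂ hit by (F1), per-cap cost `≈ 2σ²(ηS)^{1/2}t^{-3/4}`; TKS₃ not: `(b)₃ → ∞`,
`(a)₃ ≥ σ³S/(2.5α²ℓ)`; dodging impossible — truncated `C²` convergence with `R(σ) ≥ 11M` forces the
image slabs to sweep the late near annulus; structural reason: Kirchhoff needs `sup|∂ᵥ³(rh)|`, and 1-d
Agmon bounds the focused `C²` by `𝔑₃`, not by `𝔑₂` — "`Cᵐ` conclusion ⇔ thrift order ≥ m+1");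
S_M₃'s flux finiteness needs whole-slab recurrence order ≥ 7 (not 6). (W5) S_T⁺ certified: its
certificate conjunct ⇔ the ray clause, its consequent ⇔ the settle matrix, and `X → S_T⁺` (all in
Lean, `stub_clusterSettlingRecurrent.cert.lean`): the cut is sound and NECESSARY; residual content =
all-time far-field `C²` decay between instants (unprinted PDE, fed by no typed hypothesis — it is the
restart's theorem). (W6) RECENTRING DEFECT found and repaired: `RecedingKerr.nearLayer` is the cylinder
`{|x̲| ≤ ℓ}` about the chart ORIGIN, so the origin-centred hand-over sup-controls at most one hole;
v2.1 adds per-hole recentred layers `Φᵢ` (centres `fun j ↦ ξ j - ξ i`) to the hand-over of S_M₃ and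
S_T⁺ (monotone strengthening; inherited from the sibling's `ThriftyClusterSettling`, cross-route note
filed). Second-order alert D2 (W6, for S_K₃/stmt-17610): the `Fin 1` layer of TKS excises only its own
core, so inside an `N ≥ 2` development its far leaves would have to span the other holes achronally at
small cost — impossible; S_T⁺'s prover applies S_K₃ to AUXILIARY single-hole developments glued from
the recentred layer data (domain of dependence over the decoupling window ≈ ε⁻¹) — that IS the
decoupling content of S_T⁺, now stated where it lives.

v3 (lead c15, `prover-line-stmt-FinalStateConjecture-14526-c15-0`, 2026-08-17): SYNCHRONISATION. `RecursO`'s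
recurrence clause C13 certifies the flat chart on the LAB slab `{x⁰ = τ}` and hole `i` on the REST slab
`{(Λᵢ⁻¹(x − cᵢ))⁰ = τ}` at ONE parameter `τ`; along hole `i`'s world-line `cᵢ + sΛᵢe₀` the rest time
advances by `s` while the lab time advances by `γᵢ s` (`poincareInv_add_smul`), so the certified epochs
of the holes (`cᵢ⁰ + γᵢτ`) and of the flat region (`τ`) drift apart linearly — lead c10's interface
defect D1 of X (2026-08-16), unrepaired at rev 21, never confronted with this line. The hand-over S_M₃
is ONE `N`-hole layer at ONE lab time, so under rev-21 X its "near part = short-time Cauchy stability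
from the recurrent jet" silently needs near-zone Kerr control across gaps `~|γᵢ − γⱼ|τ` (`N ≥ 2`,
distinct Lorentz factors: O1-type content inside S_M, contradicting the card's "S_M is weak-field").
v3 RESHAPE (composition unchanged): S_M₃ ⇐ S_Y `stub_synchronisedRecurrence` (`∀ k ∃ k'`, `RecursO k'
⇒` lab-synchronous recurrence at order `k`: C1–C12 verbatim, C13ˢ with hole `i` certified at rest
parameter `(t − cᵢ⁰)/γᵢ`) + S_M₃ˢ `stub_thriftyLayersFromSyncRecurrence3` (manufacture from
lab-synchronous recurrence = c14's three pieces honestly). S_Y is the typed home of the defect: O1-hard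
under rev 21, trivial (`k' = k`) once X's C13 is restated lab-synchronously.

v3.1 (lead c15, same day): the synchronous block is the LANDED vocabulary `RecursSync k 𝒟`
(…SyncRecurrenceDefs: C1–C12 verbatim + C13ˢ lab-synchronous, THICK (windows of every width —
they feed the interior collar) and RADIALLY OVERLAPPING (hole `i` certified out to its exhaustion
radius `Rᵢ`, closing c14's `C⁰`-only annulus O2)); S_Y: `RecursO k' → RecursSync k`; S_M₃ˢ:
`RecursSync k →` hand-over₃. Certificates: `EpochDrift.lean` (wave-1 W1), `SyncOfRest.lean` (lead).

REGISTERED STUBS (v3.1 = v3 names): S_F `stub_farExteriorControl`, S_G `stub_entryBandGlue_eventual`, S_Y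
`stub_synchronisedRecurrence`, S_M₃ˢ `stub_thriftyLayersFromSyncRecurrence3`, S_K₃
`stub_thriftyKerrStability3`, S_T⁺ `stub_clusterSettlingRecurrent`; CLOSED S_R′
`stub_raysStayInClosure_transfer_cofinal` (p153526); DERIVED S_M₃ `stub_thriftyLayersFromRecurrence3`.

Formerly REGISTERED STUBS (v2.1): S_F `stub_farExteriorControl` (F″, verbatim), S_G `stub_entryBandGlue_eventual`
(G′, verbatim), S_M₃ `stub_thriftyLayersFromRecurrence3`, S_K₃ `stub_thriftyKerrStability3`, S_T⁺
`stub_clusterSettlingRecurrent`, S_R′ `stub_raysStayInClosure_transfer_cofinal`.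
COMPOSITION `LinearToNonlinearCapture_of` (sorry-free, conclusion = the route decl BY NAME): `k := max
k_M k_T` (`recursO_anti`); given `RecursO k 𝒟`: S_M₃ gives the order-3 hand-over, S_T⁺ (fed with S_K₃)
the settle matrix and a cofinality certificate `∃ U, RaysStayInClosure (exteriorOf U) ∧ U ⊆ closure O′`,
S_R′ the ray clause of `O′`, and the scri column (F″ + G′ + landed S_C) complete `𝓘⁺`.

DEAD LINES avoided at the step each died: as v1 (card `Lines/thrift-handoff.md`). DISPROOF USED: none
exists (`ledger crux ls` 2026-08-17T09:0xZ). Wave-1 evidence: `stub_raysStayInClosure_transfer.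
plumbing.lean`, `stub_clusterSettlingFarControlled.findings.md`, `stub_thriftyKerrStability.findings.md`.
-/

namespace Summit.FinalStateConjecture.FinalStateConjecture.Cruxes.LinearToNonlinearCapture.ThriftHandoff

set_option linter.dupNamespace false
-- nested operator types `E4 →L[ℝ] E4 →L[ℝ] ℝ` and their iterated derivatives (as in the live skeleton)
set_option maxSynthPendingDepth 3

open scoped BigOperators Topology Manifold ENNReal ContDiff
open Filter Set Function TopologicalSpace Bundle MeasureTheory
open Literature.Geometry.Lorentzian
open Summit.FinalStateConjecture.FinalStateConjecture.Theses.ClusterCompleteness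
open Summit.FinalStateConjecture.FinalStateConjecture.Theorems.ClusterCompleteness
open Summit.FinalStateConjecture.FinalStateConjecture.Theorems.StarvedNecks.OneOverDelta

/-- **Stub S_F (`stub_farExteriorControl`, F″) — VERBATIM the live line's registered stub** (skeleton
v4 of `exterior-entry-capture`): ONE Klainerman–Nicolò-type statement for the admissible class —
COMPLETE (K-avoiding normalised rays complete) ∧ FAR CHART (smooth open embedding, cone-adapted shell,
covering `J⁺(ιΣ) ∖ J⁺(ιK)`, `dΦ(∂₀)` future-directed, weighted `C⁰/C¹` closeness to `η`, no `C²` line)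
∧ ESCAPE ∧ FAR ENTRY (Doppler ∈ [1/2, 2] on the entry band). Frontier item (class `(s,q) = (3,1)`;
every print needs `q ≥ 2`: KN 2003 Thm 3.7.1, Shen arXiv:2303.12758 Thm 1.7, Bieri 2010). [XL] -/
theorem stub_farExteriorControl :
    ∀ (X : Type) [TopologicalSpace X] [ChartedSpace E3 X] [IsManifold (𝓡 3) ∞ X] [T2Space X]
    [SecondCountableTopology X] [ConnectedSpace X], ∀ D ∈ admissibleVacuumData X, ∀ 𝒟 :
    VacuumCauchyDevelopment D, 𝒟.IsMaximal → ∀ [𝒟.metric.HasLeviCivita], ∃ (K : Set X) (R C : ℝ) (U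
    : Opens E4) (Φ : U → 𝒟.carrier), IsCompact K ∧ (∀ (p : X) (γ : ℝ → 𝒟.carrier) (dom : Set ℝ),
    𝒟.metric.IsNormalisedNullRayFrom 𝒟.timeOrientation 𝒟.embed 𝒟.normal p γ dom → (∀ t ∈ dom, 0 ≤ t
    → γ t ∉ 𝒟.metric.causalFuture 𝒟.timeOrientation (𝒟.embed '' K)) → ¬ BddAbove dom) ∧ (ContMDiff
    𝓘(ℝ, E4) (𝓡 4) ∞ Φ ∧ Topology.IsOpenEmbedding Φ ∧ {x : E4 | 0 < x 0 ∧ x 0 + R < E4.spatialNorm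
    x} ⊆ (U : Set E4) ∧ 𝒟.metric.causalFuture 𝒟.timeOrientation (range 𝒟.embed) \
    𝒟.metric.causalFuture 𝒟.timeOrientation (𝒟.embed '' K) ⊆ Φ '' {x : U | 0 ≤ x.1 0 ∧ x.1 0 + R <
    E4.spatialNorm x.1} ∧ (∀ x : U, 𝒟.timeOrientation.IsFutureDirected (mfderiv 𝓘(ℝ, E4) (𝓡 4) Φ x
    (E4.basisVector 0))) ∧ (∀ x : U, ‖𝒟.toSpacetime.deviation (Minkowski.backgroundOn U) Φ x‖ ≤ C *
    Real.log (2 + E4.spatialNorm x.1) / (1 + E4.spatialNorm x.1)) ∧ (∀ x : U, ‖fderiv ℝ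
    (𝒟.toSpacetime.deviationExtend (Minkowski.backgroundOn U) Φ) x.1‖ ≤ C * Real.log (2 +
    E4.spatialNorm x.1) / ((1 + E4.spatialNorm x.1) * (1 + |x.1 0 - E4.spatialNorm x.1|)))) ∧ (∀ K'
    : Set X, IsCompact K' → ∃ K'' : Set X, IsCompact K'' ∧ ∀ q ∈ 𝒟.metric.causalFuture
    𝒟.timeOrientation (range 𝒟.embed), q ∉ 𝒟.metric.causalFuture 𝒟.timeOrientation (𝒟.embed '' K'')
    → ∃ (p : X) (γ : ℝ → 𝒟.carrier) (dom : Set ℝ) (t : ℝ), 𝒟.metric.IsNormalisedNullRayFrom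
    𝒟.timeOrientation 𝒟.embed 𝒟.normal p γ dom ∧ t ∈ dom ∧ 0 ≤ t ∧ γ t = q ∧ ∀ t' ∈ dom, 0 ≤ t' → γ
    t' ∉ 𝒟.metric.causalFuture 𝒟.timeOrientation (𝒟.embed '' K')) ∧ ∀ K' : Set X, IsCompact K' → ∃
    Bs : Set X, IsCompact Bs ∧ ∀ B : Set X, IsCompact B → Bs ⊆ B → ∃ R' : ℝ, ∀ t₁ : ℝ, ∃ B₁ : Set X,
    IsCompact B₁ ∧ ∀ p ∉ B₁, ∀ (γ : ℝ → 𝒟.carrier) (dom : Set ℝ), 𝒟.metric.IsNormalisedNullRayFrom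
    𝒟.timeOrientation 𝒟.embed 𝒟.normal p γ dom → (∃ t ∈ dom, 0 ≤ t ∧ γ t ∈ 𝒟.metric.causalFuture
    𝒟.timeOrientation (𝒟.embed '' B)) → ∃ (s₀ : ℝ) (x : U) (w : E4), s₀ ∈ dom ∧ 0 ≤ s₀ ∧ γ s₀ ∈
    𝒟.metric.causalFuture 𝒟.timeOrientation (𝒟.embed '' B) ∧ γ s₀ ∉ 𝒟.metric.causalFuture
    𝒟.timeOrientation (𝒟.embed '' K') ∧ γ s₀ = Φ x ∧ t₁ ≤ x.1 0 ∧ x.1 0 + R < E4.spatialNorm x.1 ∧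
    E4.spatialNorm x.1 ≤ x.1 0 + R' ∧ velocity (𝓡 4) γ s₀ = mfderiv 𝓘(ℝ, E4) (𝓡 4) Φ x w ∧ 1 / 2 ≤ w
    0 ∧ w 0 ≤ 2 := by
  sorry

/-- **Stub S_G (`stub_entryBandGlue_eventual`, G′) — VERBATIM the live line's registered stub**
(skeleton v4): entry-band gluing and ray-wise EVENTUAL frame pinning (`0 < w′⁰ ≤ L` at a LATER
flat-charted point with room), from a legal exhaustive future-oriented `C²` decomposition and a far
chart of F″ quality. Classical Lorentzian geometry (Lorentzian John at the position level, BMO tilt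
law, John–Nirenberg; vortex cores transient along rays). [XL in Lean] -/
theorem stub_entryBandGlue_eventual :
    ∀ (X : Type) [TopologicalSpace X] [ChartedSpace E3 X] [IsManifold (𝓡 3) ∞ X] [T2Space X]
    [SecondCountableTopology X] [ConnectedSpace X], ∀ D ∈ admissibleVacuumData X, ∀ 𝒟 :
    VacuumCauchyDevelopment D, 𝒟.IsMaximal → ∀ (O : Set 𝒟.carrier) (d : FinalStateDecomposition
    𝒟.toSpacetime O 2), O = Summit.FinalStateConjecture.exteriorOf 𝒟.toCauchyDevelopment d.charted →
    Summit.FinalStateConjecture.HasExhaustiveCharts d → Summit.FinalStateConjecture.IsFutureOriented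
    d → ∀ (K : Set X) (R C : ℝ) (U : Opens E4) (Φ : U → 𝒟.carrier), (ContMDiff 𝓘(ℝ, E4) (𝓡 4) ∞ Φ ∧
    Topology.IsOpenEmbedding Φ ∧ {x : E4 | 0 < x 0 ∧ x 0 + R < E4.spatialNorm x} ⊆ (U : Set E4) ∧
    𝒟.metric.causalFuture 𝒟.timeOrientation (range 𝒟.embed) \ 𝒟.metric.causalFuture
    𝒟.timeOrientation (𝒟.embed '' K) ⊆ Φ '' {x : U | 0 ≤ x.1 0 ∧ x.1 0 + R < E4.spatialNorm x.1} ∧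
    (∀ x : U, 𝒟.timeOrientation.IsFutureDirected (mfderiv 𝓘(ℝ, E4) (𝓡 4) Φ x (E4.basisVector 0))) ∧
    (∀ x : U, ‖𝒟.toSpacetime.deviation (Minkowski.backgroundOn U) Φ x‖ ≤ C * Real.log (2 +
    E4.spatialNorm x.1) / (1 + E4.spatialNorm x.1)) ∧ (∀ x : U, ‖fderiv ℝ
    (𝒟.toSpacetime.deviationExtend (Minkowski.backgroundOn U) Φ) x.1‖ ≤ C * Real.log (2 +
    E4.spatialNorm x.1) / ((1 + E4.spatialNorm x.1) * (1 + |x.1 0 - E4.spatialNorm x.1|)))) → ∀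
    [𝒟.metric.HasLeviCivita], ∃ (O' : Set 𝒟.carrier) (d' : FinalStateDecomposition 𝒟.toSpacetime O'
    2) (L : ℝ), 0 < L ∧ ∀ R' τ T : ℝ, ∃ t₁ : ℝ, ∀ (p : X) (γ : ℝ → 𝒟.carrier) (dom : Set ℝ) (s₀ : ℝ)
    (x : U) (w : E4), 𝒟.metric.IsNormalisedNullRayFrom 𝒟.timeOrientation 𝒟.embed 𝒟.normal p γ dom →
    s₀ ∈ dom → 0 ≤ s₀ → γ s₀ = Φ x → t₁ ≤ x.1 0 → x.1 0 + R < E4.spatialNorm x.1 → E4.spatialNorm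
    x.1 ≤ x.1 0 + R' → Φ x ∈ closure O → velocity (𝓡 4) γ s₀ = mfderiv 𝓘(ℝ, E4) (𝓡 4) Φ x w → w 0 ≤
    2 → ¬ BddAbove dom ∨ ∃ (s : ℝ) (y : d'.flatDomain) (w' : E4), s ∈ dom ∧ s₀ ≤ s ∧ γ s ∈
    𝒟.metric.causalFuture 𝒟.timeOrientation {γ s₀} ∧ γ s = d'.flatChart y ∧ d'.τ₀ < y.1 0 ∧ τ ≤ y.1
    0 ∧ {z : E4 | y.1 0 ≤ z 0 ∧ z 0 ≤ y.1 0 + T ∧ ‖E4.spatial z - E4.spatial y.1‖ ≤ 2 * (z 0 - y.1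
    0) + 1} ⊆ (d'.flatDomain : Set E4) ∧ velocity (𝓡 4) γ s = mfderiv 𝓘(ℝ, E4) (𝓡 4) d'.flatChart y
    w' ∧ 0 < w' 0 ∧ w' 0 ≤ L := by
  sorry

/-- **Stub S_Y (`stub_synchronisedRecurrence`; SYNCHRONISATION — v3.1, lead c15).** For every order
`k` there is an order `k'` such that every maximal vacuum Cauchy development of admissible data with
`RecursO k' 𝒟` (X's rev-21 hypothesis VERBATIM) recurs in the consumer-side repaired sense
`RecursSync k 𝒟` (…LinearToNonlinearCaptureSyncRecurrenceDefs, landed vocabulary): the SAME eleven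
chart objects and clauses C1–C12 byte-identical, with the recurrence clause C13 replaced by C13ˢ —
for every radius `R'`, window `W` and `ε > 0`, frequently in LAB time `t`, for every lab time
`s ∈ [t − W, t]` the flat chart is `ε`-flat in `Cᵏ` on `{x⁰ = s}` and every hole chart `Ψᵢ` is
`ε`-Kerr in `Cᵏ` on its rest slab of the SYNCHRONISED parameter `σᵢ(s) = (s − cᵢ⁰)/γᵢ`
(`cᵢ = (mo i).2`, `γᵢ = (Λᵢe₀)⁰ > 0` by C11; the rest slab through the world-line point of lab
time `s`), truncated at `max R' (Rᵢ(σᵢ(s)))` (the hypothesis's own exhaustion radius), with the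
transported Kerr time vectors future-directed there. WHY THIS STUB EXISTS (the defects it isolates,
all on the consumer side of X's interface): (D1, lead c10, unrepaired at rev 21) `RecursO`'s C13
certifies the flat chart at LAB epoch `τ` and hole `i` at REST parameter `τ`, i.e. at lab epoch
`cᵢ⁰ + γᵢτ` — along the world-line `cᵢ + sΛᵢe₀` the rest time advances by `s` and the lab time by
`γᵢ s` (`poincareInv_add_smul`; certificate `EpochDrift.lean`, wave 1) — so the certified epochs
DRIFT APART linearly and no recurrent parameter certifies ONE Cauchy slab through all `N` near
zones and the far region, which is what a restart layer at one lab time consumes; for `N ≥ 2`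
holes with distinct Lorentz factors this costs near-zone Kerr control across gaps
`~|γᵢ − γⱼ|τ → ∞` from an `ε`-instant (O1-type content; domain of dependence + small-data Kerr
stability control a near zone only for time `≲ R'`, fixed before the epoch), for `N = 1`, `γ₁ > 1`
the forward weak-field gap `(γ₁ − 1)τ`; (thickness) an INSTANT certifies nothing to the past of
the slab near the horizon, while the interior collar `{Mᵢ < rᵢ ≤ r₊}` of the layer is fed exactly
by the horizon crossings during a window before the epoch (red-shift bookkeeping); (O2, lead c14)
C13's fixed certification radius `R'` stops inside the sublinearly growing tube, leaving a
`C⁰ ≤ 1/4`-only annulus `{R' < rᵢ < ρᵢ}` that the layer's far leaves cross. Under rev-21 X this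
stub is O1-hard; it is the IDENTITY (`k' = k`) the day X's C13 is restated as C13ˢ (the repair this
lead recommends to the planner; the ω-limit toolkit of crux #9 yields common return times of
product flows in any fixed direction and convergence on compact windows, so it serves C13ˢ as well
as C13). Consistency: convergent charts satisfy C13ˢ (`syncClause_of_tendsto`), at-rest zero-offset
labels turn C13 into the instant case of C13ˢ (`syncRecurrence_of_recursO_of_atRest`; both in the
evidence file `SyncOfRest.lean`); exact Minkowski/Kerr: deviations vanish. A would-be SOFT
derivation of C13ˢ from C13 is false already as filter logic (`not_softSync`, `EpochDrift.lean`).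
Leans on: `RecursO` (BirthDefs), `RecursSync` (SyncRecurrenceDefs); nothing printed. [typed
defect-isolating stub; O1-hard under rev 21 / identity after the restatement] -/
theorem stub_synchronisedRecurrence :
    ∀ k : ℕ, ∃ k' : ℕ, ∀ (X : Type) [TopologicalSpace X] [ChartedSpace E3 X] [IsManifold (𝓡 3) ∞ X] [T2Space X]
    [SecondCountableTopology X] [ConnectedSpace X], ∀ D ∈ admissibleVacuumData X, ∀ 𝒟 :
    VacuumCauchyDevelopment D, 𝒟.IsMaximal → RecursO k' 𝒟 → RecursSync k 𝒟 := by
  sorry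

/-- **Stub S_M₃ˢ (`stub_thriftyLayersFromSyncRecurrence3`; MANUFACTURE at thrift order 3 from
lab-synchronous thick recurrence — v3.1, lead c15; the line's own stub, hardest; held by the lead).**
For some order `k`: every maximal vacuum Cauchy development of admissible data with `RecursSync k 𝒟`
(C1–C12 of `RecursO` verbatim + C13ˢ: lab-synchronous, on windows of every width, hole `i`
certified out to its exhaustion radius) admits the THRIFTY HAND-OVER of v2.1 verbatim (`N`,
sub-extremal labels, orthochronous motions, and for every scale `ℓ > 0`, accuracy `ε > 0`, lateness
`τ₁` a lab time `τ ≥ τ₁`, separated non-approaching centres, a smooth open embedding `Φ` of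
`RecedingKerr.layer M a Λ ξ τ ℓ` with image in `J⁺(ιΣ)`, achronal leaves, `𝔑_(3,1/2,1/2)(Φ) ≤ ε`,
and the recentred per-hole layers `Φᵢ`). With a synchronous THICK epoch (launch at `τ = t − ℓ − d`,
`d` the cluster diameter, window `W ≥ 2(ℓ + d)`) the near-EXTERIOR part of the layer lies inside the
union of certified slab pieces (bookkeeping, no Cauchy stability), the far leaves (retarded times
within `ℓ` of `τ`) see the holes only during certified lab times, and what remains is: (i) GLUING —
on the overlap annuli the transition maps `Ψ₀⁻¹ ∘ Ψᵢ` are `ε`-close in `Cᵏ` to Poincaré maps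
`Pᵢ` that nothing ties to the identity (the hole's true motion in the flat chart's frame is
`Pᵢ ∘ (Λᵢ, cᵢ)`, drifting sublinearly between epochs): Lorentzian John on dyadic annuli × window
and a partition of unity (closable in kind; toolkit not in tree, cf. lead c13's L-lemmas);
(ii) INTERIOR COLLAR `{Mᵢ < rᵢ ≤ r₊}` — fed by the window (horizon crossings during the last
`O(r₊ − Mᵢ)` of advanced time were in the certified exterior window; lingering near-horizon junk
is red-shifted; interior Cauchy stability on the compact `r`-range uniformly in advanced time):
printed ingredients, unprinted assembly; (iii) FAR LEAVES in the late wave zone (T2): converting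
whole-slab UNWEIGHTED `ε`-flatness into `r^{1/2}`/`r^{-3/2}`-weighted order-3 flux smallness needs
the `1/r` wave-zone structure of large-data developments at late times plus admissibility of the
data tail (whole-slab order ≥ 7 for finiteness, c14 W4/W6) — unprinted, weak-field, the sharpest
remaining point; (iv) achronality of the asymptotically null far leaves (needs `r`-decay of the
deviation: part of T2, not of the `C⁰` anchor). Leans on: `RecedingKerr.layer`,
`Spacetime.recedingKerrInitialLayerNorm`, `RecursSync`, local Cauchy stability, Dafermos–Rodnianski
`r^p` (arXiv:0910.4957), red-shift (arXiv:0811.0354 §§5.1, 7), F. John 1961. [XL] -/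
theorem stub_thriftyLayersFromSyncRecurrence3 :
    ∃ k : ℕ, ∀ (X : Type) [TopologicalSpace X] [ChartedSpace E3 X] [IsManifold (𝓡 3) ∞ X] [T2Space X]
    [SecondCountableTopology X] [ConnectedSpace X], ∀ D ∈ admissibleVacuumData X, ∀ 𝒟 :
    VacuumCauchyDevelopment D, 𝒟.IsMaximal → RecursSync k 𝒟 → (∃ (N :
    ℕ) (M a : Fin N → ℝ) (Λ : Fin N → lorentzGroup), (∀ i, Kerr.IsSubextremal (M i) (a i)) ∧ (∀ i,
    Summit.FinalStateConjecture.IsOrthochronous (Λ i)) ∧ ∀ ℓ : ℝ, 0 < ℓ → ∀ ε : ℝ, 0 < ε → ∀ τ₁ :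
    ℝ, ∃ τ : ℝ, τ₁ ≤ τ ∧ ∃ (ξ : Fin N → E3) (Φ : RecedingKerr.layer M a Λ ξ τ ℓ → 𝒟.carrier), (∀ i
    j, i ≠ j → ε⁻¹ ≤ ‖ξ i - ξ j‖ ∧ 0 ≤ @inner ℝ E3 _ (ξ i - ξ j) ((((Λ i : E4 ≃L[ℝ] E4)
    (E4.basisVector 0)) 0)⁻¹ • E4.spatial ((Λ i : E4 ≃L[ℝ] E4) (E4.basisVector 0)) - (((Λ j : E4
    ≃L[ℝ] E4) (E4.basisVector 0)) 0)⁻¹ • E4.spatial ((Λ j : E4 ≃L[ℝ] E4) (E4.basisVector 0)))) ∧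
    ContMDiff 𝓘(ℝ, E4) (𝓡 4) ∞ Φ ∧ Topology.IsOpenEmbedding Φ ∧ Set.range Φ ⊆ 𝒟.metric.causalFuture
    𝒟.timeOrientation (Set.range 𝒟.embed) ∧ (∀ s₀ ∈ Set.Ioo 0 ℓ, 𝒟.metric.IsAchronal
    𝒟.timeOrientation (Φ '' {x | RecedingKerr.layerTime τ ℓ x.1 = s₀})) ∧
    𝒟.toSpacetime.recedingKerrInitialLayerNorm M a Λ ξ τ ℓ 3 (1 / 2) (1 / 2) Φ ≤ ENNReal.ofReal ε ∧
    ∀ i : Fin N, ∃ Φᵢ : RecedingKerr.layer M a Λ (fun j ↦ ξ j - ξ i) τ ℓ → 𝒟.carrier, ContMDiff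
    𝓘(ℝ, E4) (𝓡 4) ∞ Φᵢ ∧ Topology.IsOpenEmbedding Φᵢ ∧ Set.range Φᵢ ⊆ 𝒟.metric.causalFuture
    𝒟.timeOrientation (Set.range 𝒟.embed) ∧ (∀ s₀ ∈ Set.Ioo 0 ℓ, 𝒟.metric.IsAchronal
    𝒟.timeOrientation (Φᵢ '' {x | RecedingKerr.layerTime τ ℓ x.1 = s₀})) ∧
    𝒟.toSpacetime.recedingKerrInitialLayerNorm M a Λ (fun j ↦ ξ j - ξ i) τ ℓ 3 (1 / 2) (1 / 2) Φᵢ ≤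
    ENNReal.ofReal ε) := by
  sorry

/-- **S_M₃ (`stub_thriftyLayersFromRecurrence3`) — DERIVED since v3 (lead c15) from S_Y `stub_synchronisedRecurrence`
and S_M₃ˢ `stub_thriftyLayersFromSyncRecurrence3` (registered signature of v2.1 verbatim; two lines of logic:
`k := k'(k_M)`).** v2.1 text (lead c14): MANUFACTURE at thrift order 3 — the line's own
stub, hardest. For some order `k`: every maximal vacuum Cauchy development of
admissible data with `RecursO k 𝒟` (X's rev-21 hypothesis verbatim) admits the THRIFTY HAND-OVER:
`N`, sub-extremal labels, orthochronous motions (equal terminal velocities allowed), and for every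
scale `ℓ > 0`, accuracy `ε > 0` and lateness `τ₁` a lab time `τ ≥ τ₁`, centres pairwise `≥ ε⁻¹` apart
and non-approaching, and a smooth open embedding `Φ` of `RecedingKerr.layer M a Λ ξ τ ℓ` into `𝒟`
with image in `J⁺(ιΣ)`, achronal leaves and layer norm `𝔑_(3,1/2,1/2)(Φ) ≤ ε` (order 3, v2: the
order-2 currency does not see the bounded-radius cap trains that the restart's conclusion must
exclude). THREE pieces of mathematics (census T2 + lead c14): (i) near EXTERIOR part — short-time
Cauchy stability from the recurrent `Cᵏ` jet on `{r₊ < rᵢ ≤ R′}`; (ii) INTERIOR COLLAR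
`{Mᵢ < rᵢ ≤ r₊}` — NOT in the future domain of dependence of any exterior slab piece (inside the
horizon `r` is a past-increasing time function), so not fed by (i): area-law pinning (mass labels
recur ⇒ late horizon flux → 0) + red-shift stability along `𝓗⁺`, unprinted as stated; (iii) FAR
LEAVES in the late wave zone (`u ≈ τ`, to the future of the recurrent slab, only the `C⁰` anchor
there): the radiation field frozen at the recurrent retarded time is small near `r ≈ R` by
whole-slab recurrence, old outgoing radiation stays at earlier retarded time, admissibility starves
the incoming supply — weak-field, long-time, unprinted. `∃ k` is load-bearing (whole-slab order ≥ 7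
makes the data tail's order-3 layer fluxes finite: wave-2 workers W4/W6, `5k > 34`). v2.1 (wave 2,
worker W6): the hand-over ALSO provides, for every hole `i`, a layer chart `Φᵢ` of the same
configuration RECENTRED at `ξ i` (`RecedingKerr.nearLayer` is the cylinder `{|x̲| ≤ ℓ}` about the
chart origin, so the origin-centred `Φ` sup-controls at most one hole once `ε < 1/(2ℓ)`; the
recentred `Φᵢ` is what a per-hole application of S_K₃ consumes — a typing defect inherited from the
sibling's `ThriftyClusterSettling` hand-over, repaired here monotonically). Leans on: `RecursO`, `RecedingKerr.layer`,
`Spacetime.recedingKerrInitialLayerNorm`, local Cauchy stability, Dafermos–Rodnianski `r^p`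
(arXiv:0910.4957) and red-shift (arXiv:0811.0354 §5.1). [XL] -/
theorem stub_thriftyLayersFromRecurrence3 :
    ∃ k : ℕ, ∀ (X : Type) [TopologicalSpace X] [ChartedSpace E3 X] [IsManifold (𝓡 3) ∞ X] [T2Space
    X] [SecondCountableTopology X] [ConnectedSpace X], ∀ D ∈ admissibleVacuumData X, ∀ 𝒟 :
    VacuumCauchyDevelopment D, 𝒟.IsMaximal → RecursO k 𝒟 → (∃ (N : ℕ) (M a : Fin N → ℝ) (Λ : Fin N →
    lorentzGroup), (∀ i, Kerr.IsSubextremal (M i) (a i)) ∧ (∀ i,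
    Summit.FinalStateConjecture.IsOrthochronous (Λ i)) ∧ ∀ ℓ : ℝ, 0 < ℓ → ∀ ε : ℝ, 0 < ε → ∀ τ₁ : ℝ,
    ∃ τ : ℝ, τ₁ ≤ τ ∧ ∃ (ξ : Fin N → E3) (Φ : RecedingKerr.layer M a Λ ξ τ ℓ → 𝒟.carrier), (∀ i j, i
    ≠ j → ε⁻¹ ≤ ‖ξ i - ξ j‖ ∧ 0 ≤ @inner ℝ E3 _ (ξ i - ξ j) ((((Λ i : E4 ≃L[ℝ] E4) (E4.basisVector
    0)) 0)⁻¹ • E4.spatial ((Λ i : E4 ≃L[ℝ] E4) (E4.basisVector 0)) - (((Λ j : E4 ≃L[ℝ] E4)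
    (E4.basisVector 0)) 0)⁻¹ • E4.spatial ((Λ j : E4 ≃L[ℝ] E4) (E4.basisVector 0)))) ∧ ContMDiff
    𝓘(ℝ, E4) (𝓡 4) ∞ Φ ∧ Topology.IsOpenEmbedding Φ ∧ Set.range Φ ⊆ 𝒟.metric.causalFuture
    𝒟.timeOrientation (Set.range 𝒟.embed) ∧ (∀ s₀ ∈ Set.Ioo 0 ℓ, 𝒟.metric.IsAchronal
    𝒟.timeOrientation (Φ '' {x | RecedingKerr.layerTime τ ℓ x.1 = s₀})) ∧
    𝒟.toSpacetime.recedingKerrInitialLayerNorm M a Λ ξ τ ℓ 3 (1 / 2) (1 / 2) Φ ≤ ENNReal.ofReal ε ∧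
    ∀ i : Fin N, ∃ Φᵢ : RecedingKerr.layer M a Λ (fun j ↦ ξ j - ξ i) τ ℓ → 𝒟.carrier, ContMDiff
    𝓘(ℝ, E4) (𝓡 4) ∞ Φᵢ ∧ Topology.IsOpenEmbedding Φᵢ ∧ Set.range Φᵢ ⊆ 𝒟.metric.causalFuture
    𝒟.timeOrientation (Set.range 𝒟.embed) ∧ (∀ s₀ ∈ Set.Ioo 0 ℓ, 𝒟.metric.IsAchronal
    𝒟.timeOrientation (Φᵢ '' {x | RecedingKerr.layerTime τ ℓ x.1 = s₀})) ∧
    𝒟.toSpacetime.recedingKerrInitialLayerNorm M a Λ (fun j ↦ ξ j - ξ i) τ ℓ 3 (1 / 2) (1 / 2) Φᵢ ≤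
    ENNReal.ofReal ε) := by
  obtain ⟨kM, hM⟩ := stub_thriftyLayersFromSyncRecurrence3
  obtain ⟨k', hY⟩ := stub_synchronisedRecurrence kM
  exact ⟨k', fun X _ _ _ _ _ _ D hD 𝒟 hmax hR ↦ hM X D hD 𝒟 hmax (hY X D hD 𝒟 hmax hR)⟩

/-- **Stub S_K₃ (`stub_thriftyKerrStability3`) — the sibling crux at thrift order 3.** VERBATIM the
text of route DerivativeThrift's `ThriftyKerrStability` (stmt-FinalStateConjecture-17610) with the
layer norm `𝔑_(3,1/2,1/2)` in place of `𝔑_(2,1/2,1/2)`: for every sub-extremal `(M₀,a₀)`, scale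
`ℓ ≥ 4M₀` and `η > 0` an `ε > 0` such that in every MGHD of admissible data every smooth open
embedding of the single-Kerr hyperboloidal layer with image in `J⁺(ιΣ)`, achronal leaves and
`𝔑_(3,1/2,1/2) ≤ ε` is followed by a sub-extremal Kerr near zone `(M′,a′)`, `|M′−M₀|+|a′−a₀| ≤ η`,
converging in `C²` on truncated slabs out to `R(σ) → ∞`, eventually future-oriented. Why order 3
(wave 1, worker S_T §2.4): at order 2 a single ε-thrifty exact-Kerr layer followed by a
bounded-radius cap train (cost `Σ(ηₘSₘ)^{1/2}σ²tₘ^{-3/4} ≤ ε`) has focal `C²` events ON the truncated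
near-zone slabs of every admissible witness chart, so `TKS₂` is heuristically false (mod U1) while
`TKS₃` is not hit (`(b)₃ ≳ S³α⁻⁴η⁻¹σ⁶ℓ^{1/2}t² → ∞`). The solved siblings' theorem shape
(Klainerman–Szeftel 2023 Main Thm; GKS arXiv:2205.14808 §3; Hintz, full range) in layer form; when
DerivativeThrift restates 17610 at order 3 this stub closes by glue. [open there; XL] -/
theorem stub_thriftyKerrStability3 :
    ∀ (M₀ a₀ : ℝ), Kerr.IsSubextremal M₀ a₀ → ∀ ℓ : ℝ, 4 * M₀ ≤ ℓ → ∀ η : ℝ, 0 < η → ∃ ε : ℝ, 0 < ε ∧ ∀ (X : Type) [TopologicalSpace X] [ChartedSpace E3 X] [IsManifold (𝓡 3) ((⊤ : ℕ∞) : WithTop ℕ∞) X] [T2Space X] [SecondCountableTopology X] [ConnectedSpace X] (D : InitialDataSet (𝓡 3) X), D ∈ admissibleVacuumData X → ∀ 𝒟 : VacuumCauchyDevelopment D, 𝒟.IsMaximal → ∀ (τ : ℝ) (Φ : RecedingKerr.layer (fun _ : Fin 1 ↦ M₀) (fun _ ↦ a₀) (fun _ ↦ 1) (fun _ ↦ 0)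 τ ℓ → 𝒟.carrier), ContMDiff 𝓘(ℝ, E4) (𝓡 4) ((⊤ : ℕ∞) : WithTop ℕ∞) Φ → Topology.IsOpenEmbedding Φ → Set.range Φ ⊆ 𝒟.metric.causalFuture 𝒟.timeOrientation (Set.range 𝒟.embed) → (∀ s₀ ∈ Set.Ioo 0 ℓ, 𝒟.metric.IsAchronal 𝒟.timeOrientation (Φ '' {x | RecedingKerr.layerTime τ ℓ x.1 = s₀})) → 𝒟.toSpacetime.recedingKerrInitialLayerNorm (fun _ : Fin 1 ↦ M₀) (fun _ ↦ a₀) (fun _ ↦ 1) (fun _ ↦ 0) τ ℓ 3 (1 / 2) (1 / 2) Φ ≤ ENNReal.ofReal ε → ∃ (M' a' τ' : ℝ) (Ψ : (Kerr.background M' a').domain → 𝒟.carrier) (R : ℝ → ℝ), Kerr.IsSubextremal M' a' ∧ |M' - M₀| + |a' - a₀| ≤ η ∧ 𝒟.toSpacetime.IsLateChart (Kerr.background M' a') (𝒟.metric.causalFuture 𝒟.timeOrientation (Set.range Φ)) τ' Ψ ∧ Filter.Tendsto R Filter.atTop Filter.atTop ∧ Filter.Tendsto (fun σ ↦ 𝒟.toSpacetime.truncDeviationCk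 (Kerr.background M' a') Ψ 2 (R σ) σ) Filter.atTop (nhds 0) ∧ ∀ ρ : ℝ, ∀ᶠ σ in Filter.atTop, ∀ x ∈ (Kerr.background M' a').truncTimeSlab ρ σ, 𝒟.timeOrientation.IsFutureDirected (mfderiv 𝓘(ℝ, E4) (𝓡 4) Ψ x (Kerr.timeVector M' a' (x : E4))) := by
  sorry

/-- **Stub S_T⁺ (`stub_clusterSettlingRecurrent`) — the `N`-hole restart UNDER RECURRENCE, with the
cofinality certificate.** For some order `k`: granted S_K₃'s single-Kerr layer stability (hypothesis,
verbatim S_K₃'s statement), every maximal vacuum Cauchy development of admissible data which recurs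
at order `k` (`RecursO k 𝒟`) and admits the order-3 thrifty hand-over (verbatim S_M₃'s conclusion)
SETTLES in the re-typed sense — `∃ O d`, sub-extremal holes, `O = exteriorOf d.charted`,
`HasExhaustiveCharts d`, `IsFutureOriented d` (verbatim the conclusion of the sibling's
`ThriftyClusterSettling`, stmt-17611, whose distinct-velocity clause is dropped and whose circular
`𝓘⁺` hypothesis is not needed) — AND `O` is cofinal over some ray-complete charted exterior:
`∃ U, RaysStayInClosure (exteriorOf U) ∧ U ⊆ closure O` (intended witness `U :=` the recurrent
charts' late images after some `τ₁ > τ₀`, ray-complete by RecursO's C2/C3/C8/C9/C10 alone —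
`raysStayInClosure_recurrentCharts_late` in the S_R′ file — so the content is that the restart's
charts eventually see the recurrent ones). Why `RecursO` is a hypothesis (v2, wave-1 worker S_T):
without it the statement is heuristically false on ∀-data by the cap families (F1)/(F2); with it,
whole-slab `Cᵏ` recurrence (`k ≥ 4`) excludes both and supplies the outer-zone flat chart
(C3/C12/C13), separation (C7), exhaustion (C10) and orientation (C11) that the sibling's leads found
unfed. (D2, wave 2: S_K₃'s `Fin 1` layer is not instantiable INSIDE an `N ≥ 2` development — its far
leaves would have to span the other holes — so S_K₃ is applied to auxiliary single-hole developments
glued from the recentred layers `Φᵢ` by domain of dependence over the decoupling window; that gluing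
is part of this stub.) Content = the sibling's: receding decoupling of `N` single-hole layer-stability statements +
layer-form Minkowski stability for `N = 0` + exhaustive-chart bookkeeping across the near /
radiation / `i⁰` necks, restarted from a late recurrent instant. Leans on: S_K₃, `ThriftyMinkowski
Stability` (stmt-17613), `RecursO`, `recursO_anti`. [XL; open at thrift regularity: moving-`N`-centre
ILED unprinted] -/
theorem stub_clusterSettlingRecurrent :
    ∃ k : ℕ, (∀ (M₀ a₀ : ℝ), Kerr.IsSubextremal M₀ a₀ → ∀ ℓ : ℝ, 4 * M₀ ≤ ℓ → ∀ η : ℝ, 0 < η → ∃ ε : ℝ, 0 < ε ∧ ∀ (X : Type) [TopologicalSpace X] [ChartedSpace E3 X] [IsManifold (𝓡 3) ((⊤ : ℕ∞) : WithTop ℕ∞) X] [T2Space X] [SecondCountableTopology X] [ConnectedSpace X] (D : InitialDataSet (𝓡 3) X), D ∈ admissibleVacuumData X → ∀ 𝒟 : VacuumCauchyDevelopment D, 𝒟.IsMaximal → ∀ (τ : ℝ) (Φ : RecedingKerr.layer (fun _ : Fin 1 ↦ M₀) (fun _ ↦ a₀) (fun _ ↦ 1) (fun _ ↦ 0) τ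 ℓ → 𝒟.carrier), ContMDiff 𝓘(ℝ, E4) (𝓡 4) ((⊤ : ℕ∞) : WithTop ℕ∞) Φ → Topology.IsOpenEmbedding Φ → Set.range Φ ⊆ 𝒟.metric.causalFuture 𝒟.timeOrientation (Set.range 𝒟.embed) → (∀ s₀ ∈ Set.Ioo 0 ℓ, 𝒟.metric.IsAchronal 𝒟.timeOrientation (Φ '' {x | RecedingKerr.layerTime τ ℓ x.1 = s₀})) → 𝒟.toSpacetime.recedingKerrInitialLayerNorm (fun _ : Fin 1 ↦ M₀) (fun _ ↦ a₀) (fun _ ↦ 1) (fun _ ↦ 0) τ ℓ 3 (1 / 2) (1 / 2) Φ ≤ ENNReal.ofReal ε → ∃ (M' a' τ' : ℝ) (Ψ : (Kerr.background M' a').domain → 𝒟.carrier) (R : ℝ → ℝ), Kerr.IsSubextremal M' a' ∧ |M' - M₀| + |a' - a₀| ≤ η ∧ 𝒟.toSpacetime.IsLateChart (Kerr.background M' a') (𝒟.metric.causalFuture 𝒟.timeOrientation (Set.range Φ)) τ' Ψ ∧ Filter.Tendsto R Filter.atTop Filter.atTop ∧ Filter.Tendsto (fun σ ↦ 𝒟.toSpacetime.truncDeviationCk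 (Kerr.background M' a') Ψ 2 (R σ) σ) Filter.atTop (nhds 0) ∧ ∀ ρ : ℝ, ∀ᶠ σ in Filter.atTop, ∀ x ∈ (Kerr.background M' a').truncTimeSlab ρ σ, 𝒟.timeOrientation.IsFutureDirected (mfderiv 𝓘(ℝ, E4) (𝓡 4) Ψ x (Kerr.timeVector M' a' (x : E4)))) → ∀ (X : Type) [TopologicalSpace X] [ChartedSpace E3 X] [IsManifold (𝓡 3) ∞ X] [T2Space X] [SecondCountableTopology X] [ConnectedSpace X], ∀ D ∈ admissibleVacuumData X, ∀ 𝒟 : VacuumCauchyDevelopment D, 𝒟.IsMaximal → RecursO k 𝒟 → (∃ (N : ℕ) (M a : Fin N → ℝ) (Λ : Fin N →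
    lorentzGroup), (∀ i, Kerr.IsSubextremal (M i) (a i)) ∧ (∀ i,
    Summit.FinalStateConjecture.IsOrthochronous (Λ i)) ∧ ∀ ℓ : ℝ, 0 < ℓ → ∀ ε : ℝ, 0 < ε → ∀ τ₁ : ℝ,
    ∃ τ : ℝ, τ₁ ≤ τ ∧ ∃ (ξ : Fin N → E3) (Φ : RecedingKerr.layer M a Λ ξ τ ℓ → 𝒟.carrier), (∀ i j, i
    ≠ j → ε⁻¹ ≤ ‖ξ i - ξ j‖ ∧ 0 ≤ @inner ℝ E3 _ (ξ i - ξ j) ((((Λ i : E4 ≃L[ℝ] E4) (E4.basisVector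
    0)) 0)⁻¹ • E4.spatial ((Λ i : E4 ≃L[ℝ] E4) (E4.basisVector 0)) - (((Λ j : E4 ≃L[ℝ] E4)
    (E4.basisVector 0)) 0)⁻¹ • E4.spatial ((Λ j : E4 ≃L[ℝ] E4) (E4.basisVector 0)))) ∧ ContMDiff
    𝓘(ℝ, E4) (𝓡 4) ∞ Φ ∧ Topology.IsOpenEmbedding Φ ∧ Set.range Φ ⊆ 𝒟.metric.causalFuture
    𝒟.timeOrientation (Set.range 𝒟.embed) ∧ (∀ s₀ ∈ Set.Ioo 0 ℓ, 𝒟.metric.IsAchronal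
    𝒟.timeOrientation (Φ '' {x | RecedingKerr.layerTime τ ℓ x.1 = s₀})) ∧
    𝒟.toSpacetime.recedingKerrInitialLayerNorm M a Λ ξ τ ℓ 3 (1 / 2) (1 / 2) Φ ≤ ENNReal.ofReal ε ∧
    ∀ i : Fin N, ∃ Φᵢ : RecedingKerr.layer M a Λ (fun j ↦ ξ j - ξ i) τ ℓ → 𝒟.carrier, ContMDiff
    𝓘(ℝ, E4) (𝓡 4) ∞ Φᵢ ∧ Topology.IsOpenEmbedding Φᵢ ∧ Set.range Φᵢ ⊆ 𝒟.metric.causalFuture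
    𝒟.timeOrientation (Set.range 𝒟.embed) ∧ (∀ s₀ ∈ Set.Ioo 0 ℓ, 𝒟.metric.IsAchronal
    𝒟.timeOrientation (Φᵢ '' {x | RecedingKerr.layerTime τ ℓ x.1 = s₀})) ∧
    𝒟.toSpacetime.recedingKerrInitialLayerNorm M a Λ (fun j ↦ ξ j - ξ i) τ ℓ 3 (1 / 2) (1 / 2) Φᵢ ≤
    ENNReal.ofReal ε) → ∃ (O : Set 𝒟.carrier) (d : FinalStateDecomposition 𝒟.toSpacetime O 2), (∀ i, Kerr.IsSubextremal (d.mass i) (d.spin i)) ∧ O = Summit.FinalStateConjecture.exteriorOf 𝒟.toCauchyDevelopment d.charted ∧ Summit.FinalStateConjecture.HasExhaustiveCharts d ∧ Summit.FinalStateConjecture.IsFutureOriented d ∧ ∃ U : Set 𝒟.carrier, Summit.FinalStateConjecture.RaysStayInClosure 𝒟.toCauchyDevelopment (Summit.FinalStateConjecture.exteriorOf 𝒟.toCauchyDevelopment U) ∧ U ⊆ closure O := by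
  sorry

/-- **Stub S_R′ (`stub_raysStayInClosure_transfer_cofinal`) — COFINAL TRANSFER of the ray clause
(causal plumbing) — CLOSED: landed `Theorems.stub_raysStayInClosure_transfer_cofinal` (p153526, 2026-08-17T10:1xZ).** In a
maximal vacuum Cauchy development of admissible data, if the exterior `exteriorOf U` of some charted
set `U` captures the complete rays (`RaysStayInClosure`) and `U ⊆ closure O′` for an honest exterior
`O′ = exteriorOf d′.charted`, then `O′` captures the complete rays. Proof: `exteriorOf U ⊆ O′` —
for `q ∈ J⁺(ιΣ)` with `q ≪ p ∈ U ⊆ closure O′`, the open set `I⁺(q) ∋ p` meets `O′` in some `p′`,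
and `q ≪ p′ ≪ d′.charted` gives `q ∈ I⁻(d′.charted)`; then closures are monotone. Replaces v1's
`∀ d′` transfer, which asserted witness-independence of the settled exterior for free (a `d′`
charting a pocket behind a horizon is excluded by nothing in `RecursO`). O'Neill 1983, Ch. 14,
pp. 402–403 (openness of `I⁺`, transitivity of `≪`). [S; closable now] -/
theorem stub_raysStayInClosure_transfer_cofinal :
    ∀ (X : Type) [TopologicalSpace X] [ChartedSpace E3 X] [IsManifold (𝓡 3) ∞ X] [T2Space X]
    [SecondCountableTopology X] [ConnectedSpace X], ∀ D ∈ admissibleVacuumData X, ∀ 𝒟 :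
    VacuumCauchyDevelopment D, 𝒟.IsMaximal → ∀ (U O' : Set 𝒟.carrier) (d' :
    FinalStateDecomposition 𝒟.toSpacetime O' 2), O' = Summit.FinalStateConjecture.exteriorOf
    𝒟.toCauchyDevelopment d'.charted → Summit.FinalStateConjecture.RaysStayInClosure
    𝒟.toCauchyDevelopment (Summit.FinalStateConjecture.exteriorOf 𝒟.toCauchyDevelopment U) →
    U ⊆ closure O' → Summit.FinalStateConjecture.RaysStayInClosure 𝒟.toCauchyDevelopment O' :=
  -- CLOSED (lead c14, wave 1, p153526): the landed helper, registered signature verbatim.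
  Summit.FinalStateConjecture.FinalStateConjecture.Theorems.stub_raysStayInClosure_transfer_cofinal

/-! ### The scri column, derived exactly as in the live skeleton (F″ + G′ + landed S_C) -/

/-- Far-exterior null completeness (the former S_A), by projection of F″. -/
theorem farExteriorNullCompleteness_of_far :
    ∀ (X : Type) [TopologicalSpace X] [ChartedSpace E3 X] [IsManifold (𝓡 3) ∞ X] [T2Space X]
    [SecondCountableTopology X] [ConnectedSpace X], ∀ D ∈ admissibleVacuumData X, ∀ 𝒟 :
    VacuumCauchyDevelopment D, 𝒟.IsMaximal → ∀ [𝒟.metric.HasLeviCivita], ∃ K : Set X, IsCompact K ∧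
    ∀ (p : X) (γ : ℝ → 𝒟.carrier) (dom : Set ℝ), 𝒟.metric.IsNormalisedNullRayFrom 𝒟.timeOrientation
    𝒟.embed 𝒟.normal p γ dom → (∀ t ∈ dom, 0 ≤ t → γ t ∉ 𝒟.metric.causalFuture 𝒟.timeOrientation
    (𝒟.embed '' K)) → ¬ BddAbove dom := by
  intro X _ _ _ _ _ _ D hD 𝒟 hmax _
  obtain ⟨K, -, -, -, -, hK, hcomplete, -⟩ := stub_farExteriorControl X D hD 𝒟 hmax
  exact ⟨K, hK, hcomplete⟩

/-- Entry events (the former S_B), from F″ and G′ by causal bookkeeping (verbatim the live skeleton's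
derivation). -/
theorem radiationZoneEntry_of_far_of_glue :
    ∀ (X : Type) [TopologicalSpace X] [ChartedSpace E3 X] [IsManifold (𝓡 3) ∞ X] [T2Space X]
    [SecondCountableTopology X] [ConnectedSpace X], ∀ D ∈ admissibleVacuumData X, ∀ 𝒟 :
    VacuumCauchyDevelopment D, 𝒟.IsMaximal → (∀ [𝒟.metric.HasLeviCivita], ∃ K : Set X, IsCompact K ∧
    ∀ (p : X) (γ : ℝ → 𝒟.carrier) (dom : Set ℝ), 𝒟.metric.IsNormalisedNullRayFrom 𝒟.timeOrientation
    𝒟.embed 𝒟.normal p γ dom → (∀ t ∈ dom, 0 ≤ t → γ t ∉ 𝒟.metric.causalFuture 𝒟.timeOrientation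
    (𝒟.embed '' K)) → ¬ BddAbove dom) → (∃ (O : Set 𝒟.carrier) (d : FinalStateDecomposition
    𝒟.toSpacetime O 2), (∀ i, Kerr.IsSubextremal (d.mass i) (d.spin i)) ∧ O =
    Summit.FinalStateConjecture.exteriorOf 𝒟.toCauchyDevelopment d.charted ∧
    Summit.FinalStateConjecture.RaysStayInClosure 𝒟.toCauchyDevelopment O ∧
    Summit.FinalStateConjecture.HasExhaustiveCharts d ∧ Summit.FinalStateConjecture.IsFutureOriented
    d) → ∀ [𝒟.metric.HasLeviCivita], ∀ Bₑ : Set X, IsCompact Bₑ → ∃ B₀ : Set X, IsCompact B₀ ∧ Bₑ ⊆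
    B₀ ∧ ∃ (O'' : Set 𝒟.carrier) (d : FinalStateDecomposition 𝒟.toSpacetime O'' 2) (L : ℝ), 0 < L ∧
    ∀ τ T : ℝ, ∃ B₁ : Set X, IsCompact B₁ ∧ ∀ p ∉ B₁, ∀ (γ : ℝ → 𝒟.carrier) (dom : Set ℝ),
    𝒟.metric.IsNormalisedNullRayFrom 𝒟.timeOrientation 𝒟.embed 𝒟.normal p γ dom → (∃ t ∈ dom, 0 ≤ t
    ∧ γ t ∈ 𝒟.metric.causalFuture 𝒟.timeOrientation (𝒟.embed '' B₀)) → ¬ BddAbove dom ∨ ∃ (s₀ : ℝ)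
    (y : d.flatDomain) (w : E4), s₀ ∈ dom ∧ 0 ≤ s₀ ∧ γ s₀ ∈ 𝒟.metric.causalFuture 𝒟.timeOrientation
    (𝒟.embed '' B₀) ∧ γ s₀ = d.flatChart y ∧ d.τ₀ < y.1 0 ∧ τ ≤ y.1 0 ∧ velocity (𝓡 4) γ s₀ =
    mfderiv 𝓘(ℝ, E4) (𝓡 4) d.flatChart y w ∧ 0 < w 0 ∧ w 0 ≤ L ∧ {z : E4 | y.1 0 ≤ z 0 ∧ z 0 ≤ y.1 0
    + T ∧ ‖E4.spatial z - E4.spatial y.1‖ ≤ 2 * (z 0 - y.1 0) + 1} ⊆ (d.flatDomain : Set E4) := by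
  intro X _ _ _ _ _ _ D hD 𝒟 hmax hfar hsettles _ Bₑ hBₑ
  obtain ⟨Kh, hKh, hcomplete⟩ := hfar
  obtain ⟨O, d, -, hO, hRSIC, hexh, hfo⟩ := hsettles
  obtain ⟨Kf, R, C, U, Φ, -, -, hΦ, hesc, hent⟩ := stub_farExteriorControl X D hD 𝒟 hmax
  obtain ⟨K'', hK'', hescape⟩ := hesc Kh hKh
  obtain ⟨Bs, hBs, hentry⟩ := hent K'' hK''
  obtain ⟨O', d', L, hL, hglue⟩ :=
    stub_entryBandGlue_eventual X D hD 𝒟 hmax O d hO hexh hfo Kf R C U Φ hΦ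
  obtain ⟨R', hR'⟩ := hentry (Bₑ ∪ Bs) (hBₑ.union hBs) subset_union_right
  refine ⟨Bₑ ∪ Bs, hBₑ.union hBs, subset_union_left, O', d', L, hL, fun τ T ↦ ?_⟩
  obtain ⟨t₁, ht₁⟩ := hglue R' τ T
  obtain ⟨B₁, hB₁, hray⟩ := hR' t₁
  refine ⟨B₁, hB₁, fun p hp γ dom hγ hin ↦ ?_⟩
  obtain ⟨s₀, x, w, hs₀dom, hs₀, hJB, hJK, hγx, hxt, hxR, hxR', hvel, -, hw2⟩ :=
    hray p hp γ dom hγ hin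
  have hJrange : γ s₀ ∈ 𝒟.metric.causalFuture 𝒟.timeOrientation (range 𝒟.embed) := by
    have h := nullRay_apply_mem_causalFuture 𝒟.toSpacetime hγ.1 hγ.2.1 hγ.2.2.2.1
      hγ.2.2.2.2.1 hγ.2.1 hs₀dom hs₀
    rw [hγ.2.2.1] at h
    exact LorentzianMetric.causalFuture_mono (singleton_subset_iff.2 (mem_range_self p)) h
  obtain ⟨p', γ', dom', t', hγ', ht'dom, ht', hγ't', havoid⟩ := hescape (γ s₀) hJrange hJK
  have hcl : Φ x ∈ closure O := by
    rw [← hγx, ← hγ't']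
    exact hRSIC p' γ' dom' hγ' (hcomplete p' γ' dom' hγ' havoid) t' ht'dom ht'
  rcases ht₁ p γ dom s₀ x w hγ hs₀dom hs₀ hγx hxt hxR hxR' hcl hvel hw2 with hc |
      ⟨s, y, w', hsdom, hs₀s, hJs, hγy, hτ₀, hτy, hcone, hvel', hw'0, hw'L⟩
  · exact Or.inl hc
  · refine Or.inr ⟨s, y, w', hsdom, hs₀.trans hs₀s, ?_, hγy, hτ₀, hτy, hvel', hw'0, hw'L, hcone⟩
    exact Spacetime.causalFuture_causalFuture_subset 𝒟.toSpacetime _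
      (LorentzianMetric.causalFuture_mono (singleton_subset_iff.2 hJB) hJs)

/-- **The scri column**: settled (re-typed matrix) ⇒ complete `𝓘⁺`, for every maximal development of
admissible data, modulo F″ and G′ (S_C is the landed `Theorems.stub_scriOfEntry`). -/
theorem scri_of_settled :
    ∀ (X : Type) [TopologicalSpace X] [ChartedSpace E3 X] [IsManifold (𝓡 3) ∞ X] [T2Space X]
      [SecondCountableTopology X] [ConnectedSpace X], ∀ D ∈ admissibleVacuumData X, ∀ 𝒟 :
      VacuumCauchyDevelopment D, 𝒟.IsMaximal →
      (∃ (O : Set 𝒟.carrier) (d : FinalStateDecomposition 𝒟.toSpacetime O 2), (∀ i,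
      Kerr.IsSubextremal (d.mass i) (d.spin i)) ∧ O = Summit.FinalStateConjecture.exteriorOf
      𝒟.toCauchyDevelopment d.charted ∧ Summit.FinalStateConjecture.RaysStayInClosure
      𝒟.toCauchyDevelopment O ∧ Summit.FinalStateConjecture.HasExhaustiveCharts d ∧
      Summit.FinalStateConjecture.IsFutureOriented d) →
      Summit.FinalStateConjecture.HasCompleteNullInfinity 𝒟.toCauchyDevelopment := by
  intro X _ _ _ _ _ _ D hD 𝒟 hmax hs
  have hfar := @farExteriorNullCompleteness_of_far X _ _ _ _ _ _ D hD 𝒟 hmax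
  exact @Summit.FinalStateConjecture.FinalStateConjecture.Theorems.stub_scriOfEntry X _ _ _ _ _ _ D
    hD 𝒟 hmax hfar (@radiationZoneEntry_of_far_of_glue X _ _ _ _ _ _ D hD 𝒟 hmax hfar hs)

/-! ### Composition -/

/-- **Composition (v2).** The six stubs prove the crux BY NAME (pure logic; the only `sorry`s of this
file are inside the six `stub_*`): `k := max k_M k_T`, RecursO is antitone in the order
(`recursO_anti`), S_M₃ hands over, S_T⁺ (fed with S_K₃) settles with a cofinality certificate, S_R′
transfers the ray clause, the scri column completes `𝓘⁺`. -/
theorem LinearToNonlinearCapture_of :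
    Summit.FinalStateConjecture.FinalStateConjecture.Theses.ClusterCompleteness.LinearToNonlinearCapture := by
  intro _
  obtain ⟨kM, hM⟩ := stub_thriftyLayersFromRecurrence3
  obtain ⟨kT, hT⟩ := stub_clusterSettlingRecurrent
  refine ⟨max kM kT, ?_⟩
  intro X _ _ _ _ _ _ D hD 𝒟 hmax hhyp
  have hR : RecursO (max kM kT) 𝒟 := hhyp
  haveI : 𝒟.metric.HasLeviCivita := 𝒟.metric.toPseudoRiemannianMetric.hasLeviCivita
  have hA := hM X D hD 𝒟 hmax (recursO_anti (le_max_left _ _) hR)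
  obtain ⟨O', d', hsub, hO', hexh, hfo, U, hraysU, hU⟩ :=
    hT stub_thriftyKerrStability3 X D hD 𝒟 hmax (recursO_anti (le_max_right _ _) hR) hA
  have hRS := stub_raysStayInClosure_transfer_cofinal X D hD 𝒟 hmax U O' d' hO' hraysU hU
  have hs :
      (∃ (O : Set 𝒟.carrier) (d : FinalStateDecomposition 𝒟.toSpacetime O 2), (∀ i,
      Kerr.IsSubextremal (d.mass i) (d.spin i)) ∧ O = Summit.FinalStateConjecture.exteriorOf
      𝒟.toCauchyDevelopment d.charted ∧ Summit.FinalStateConjecture.RaysStayInClosure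
      𝒟.toCauchyDevelopment O ∧ Summit.FinalStateConjecture.HasExhaustiveCharts d ∧
      Summit.FinalStateConjecture.IsFutureOriented d) := ⟨O', d', hsub, hO', hRS, hexh, hfo⟩
  exact ⟨scri_of_settled X D hD 𝒟 hmax hs, hs⟩

/-- **Read-back (the cut is faithful to X on the settling side).** X gives `RecursO k ⇒ SettlesT2`. -/
theorem settlesT2_of_target
    (h : Summit.FinalStateConjecture.FinalStateConjecture.Theses.ClusterCompleteness.RecurrentMultiKerrCapture) :
    ∃ k : ℕ, ∀ (X : Type) [TopologicalSpace X] [ChartedSpace E3 X] [IsManifold (𝓡 3) ∞ X] [T2Space X]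
      [SecondCountableTopology X] [ConnectedSpace X], ∀ D ∈ admissibleVacuumData X,
      ∀ 𝒟 : VacuumCauchyDevelopment D, 𝒟.IsMaximal → RecursO k 𝒟 → SettlesT2 𝒟 := by
  obtain ⟨k, hk⟩ := h
  exact ⟨k, fun X _ _ _ _ _ _ D hD 𝒟 hmax hR ↦ hk X D hD 𝒟 hmax hR⟩

end Summit.FinalStateConjecture.FinalStateConjecture.Cruxes.LinearToNonlinearCapture.ThriftHandoff
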